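import Summits.BirchSwinnertonDyer.Rank1Residual.GaloisImage.SmallImageNiveauTwoSupersingular
import Summits.BirchSwinnertonDyer.Rank1Residual.Additive.LocRedOfStableLine
import HarnessLib

/-!
# `E[p]|G_{ℚ_p}` irreducible ⟺ NO `I_𝔓`-stable line in `E[p](ℚ̄)` — the two bridges between the
# LOCAL bit `LocIrr W p` (`Additive/FouquetWanLocus.lean`) and the GLOBAL inertia-image files
# (`GaloisImage/SmallImage*`), at EVERY prime `p` and every prime `𝔓 ∣ p` of `ℤ̄`
# (cell `b2b-bsdres`, team n1011, prover lineage n1011-p06 GEN 30, row T-NIV3J file 1/2 — the tool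
#  behind `GaloisImage/ThreeTorsionNiveauByJHolds.lean`; THEOREMS ONLY)

HONEST FRAMING (cell `b2b-bsdres`, run/shared/lean/b2b/bsd-rank1-residual/, verbatim in every
file): the goal of the cell is to DELETE the COMBINATION-SHAPED residual classes of the
Birch–Swinnerton-Dyer formula for ALL analytic-rank `≤ 1` elliptic curves over `ℚ` — "full BSD
formula for every rank `≤ 1` curve in class `C`" assembled STRICTLY from published theorems — so
that the rank-`≤ 1` remainder becomes exactly the CONSTRUCTION-SHAPED classes, which are TYPED
(missing-input `Prop`s), NOT attempted. This is not "finishing BSD". Research route on the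
CONSTRUCTION-SHAPED additive classes; census output = EVIDENCE, never a Literature fact; nothing is
booked here; no mark / label / count of `RESIDUAL-MAP.md` moves. This file: THEOREMS ONLY (no
definition, no named fact, no `@[conjecture]` node, no `sorry`; net named-fact debt `0`); TOOL
theorems close nothing beyond themselves.

## What is proved (`W/ℚ` elliptic, `p` prime, `v ∋ p`, `𝔓 ∈ v.primesAbove`, `I_𝔓 ≤ D_𝔓 ≤ Γ_ℚ`)

* **`locIrr_of_not_exists_inertia_stableLine`** — no `I_𝔓`-stable line (subgroup of order `p`) in
  `E[p](ℚ̄)` ⟹ `LocIrr W p`.  A `Γ_{ℚ_p}`-stable subgroup `H ≠ ⊥, ⊤` of `(W⁄ℚ_p)[p](ℚ̄_p)` has order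
  `p` (`#E[p] = p²`); its preimage under the `res`-equivariant torsion transfer
  `E[p](ℚ̄) ≃+ (W⁄ℚ_p)[p](ℚ̄_p)` (`torsionTransferEquiv`) is stable under `res Γ_{ℚ_p} = D_{𝔓₀}`
  (`decompositionSubgroup_eq_range_absGaloisRestrict`, Neukirch II (9.6), for the prime `𝔓₀ ∣ p`
  cut out by `ℚ̄ → ℚ̄_p`), hence under `I_{𝔓₀}`; conjugate primes carry stable lines
  (cc-typer-1's `GaloisImage.not_exists_stableLine_of_mem_primesAbove`, Neukirch I (9.1), (9.4)).
  This is harvest-2's `hasIrreducibleModPGaloisRep_baseChange_padic_of_dvd_frobeniusTrace`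
  argument (`Additive/LocIrrOfGoodSupersingular.lean`) with Serre's Prop. 12 replaced by the
  hypothesis; contrapositive `exists_inertia_stableLine_of_not_locIrr`.
* **`not_locIrr_of_decompositionSubgroup_stableLine`** — a `D_𝔓`-stable line, for ANY `𝔓 ∣ p`,
  gives `¬ LocIrr W p`: p05's T-LRED tool `not_locIrr_of_stable_line` is the prime `𝔓₁` cut out by
  `ℚ̄ → \bar ℚ_v` (`D_{𝔓₁} = res Γ_{ℚ_v}`, `decompositionSubgroup_adicCompletionPrime_eq_range`); a
  general `𝔓 = g • 𝔓₁` has `D_𝔓 = g D_{𝔓₁} g⁻¹` (`Ideal.decompositionSubgroup_smul`), so `g⁻¹Φ` is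
  `res Γ_{ℚ_v}`-stable.
* **`not_locIrr_of_inertia_fixedLine`** — a line of `E[p](ℚ̄)` FIXED pointwise by `I_𝔓` plus one point
  MOVED by `I_𝔓` ⟹ `¬ LocIrr W p`: the subgroup of `I_𝔓`-FIXED points contains the line, is not `E[p]`,
  hence is a line, and it is `D_𝔓`-stable because `D_𝔓` normalises `I_𝔓`
  (`inv_mul_mul_mem_inertia_of_mem_decompositionSubgroup`, from Mathlib's
  `Ideal.conj_mem_inertia_smul_iff`) — `exists_decompositionSubgroup_stableLine_of_inertia_fixedLine`.
  Two named shapes of `Additive/MixedCongruenceTameness.lean` are instances: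
  **`not_locIrr_of_twistedOrdinaryLineAt`** (`(1 ∗; 0 χ)`, `χ ≠ 1`: the additive potentially
  ordinary / potentially multiplicative residual shape) and **`not_locIrr_of_inertiaSplitAt`**
  (`χ ⊕ 1` with `ρ̄_{E,p}(I_𝔓) ≠ 1`), both at EVERY prime `p`.

Consumer (file 2/2, same row): at `p = 3` with `3 ∤ e₃` cc-typer-1's dichotomy
(`GaloisImage.card_inertia_map_three_eq_two_or_eq_eight`: `e₃ = 2 ∧ InertiaSplitAt` or `e₃ = 8 ∧`
no `I_𝔓`-stable line) turns the two bridges into `LocIrr W 3 ↔ e₃ = 8`, whence NIV3-J.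

References: J.-P. Serre, Invent. Math. 15 (1972) §1.3–§1.11 [Serre1972]; J. Neukirch, *Algebraic
Number Theory* (1999) Ch. I §9 (9.1), (9.4), (9.5), Ch. II §9 (9.6) [NeukirchANT1999]; R. Greenberg,
Adv. Stud. Pure Math. 17 (1989) §1 p. 98 (1)(b) [Greenberg1989].
-/

set_option autoImplicit false

noncomputable section

open scoped Classical NumberField Pointwise

open Field IsDedekindDomain NumberField WeierstrassCurve
  Literature.NumberTheory.EllipticCurves Literature.NumberTheory.GaloisRepresentations
  Literature.NumberTheory.EllipticCurves.Rank1Residual Rat.HeightOneSpectrum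

namespace Summit.BirchSwinnertonDyer.Rank1Residual.Additive

open MixedCongruence

/-! ## §1 No `I_𝔓`-stable line ⟹ `LocIrr` -/

section Bridge

variable (W : WeierstrassCurve ℚ) [W.IsElliptic] (p : ℕ) [hp : Fact p.Prime]
  {v : HeightOneSpectrum (𝓞 ℚ)}

/-- **No `I_𝔓`-stable line ⟹ `E[p]|G_{ℚ_p}` irreducible** (every prime `p`, every `𝔓 ∣ p` of `ℤ̄`).
If `(W⁄ℚ_p)[p](ℚ̄_p)` had a `Γ_{ℚ_p}`-stable subgroup `H ≠ ⊥, ⊤`, it would have order `p`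
(`#E[p] = p²`) and its preimage under the `res`-equivariant torsion transfer
`E[p](ℚ̄) ≃+ (W⁄ℚ_p)[p](ℚ̄_p)` would be a line stable under `res Γ_{ℚ_p} = D_{𝔓₀} ⊇ I_{𝔓₀}` for the
prime `𝔓₀ ∣ p` cut out by `ℚ̄ → ℚ̄_p` (Neukirch II (9.6)); conjugating `𝔓₀` to `𝔓` (Neukirch I (9.1),
(9.4)) gives an `I_𝔓`-stable line. [cite: NeukirchANT1999, Ch. I §9 Prop. (9.1) and Ch. II §9 Prop. (9.6)] -/
theorem locIrr_of_not_exists_inertia_stableLine (hpv : ((p : ℕ) : 𝓞 ℚ) ∈ v.asIdeal)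
    {𝔓 : Ideal (absIntegers (𝓞 ℚ) ℚ)} (h𝔓 : 𝔓 ∈ v.primesAbove)
    (hno : ¬ ∃ L : AddSubgroup (geomTorsion W (p : ℤ)), Nat.card L = p ∧
      ∀ σ ∈ 𝔓.inertia (absoluteGaloisGroup ℚ), ∀ P ∈ L, σ • P ∈ L) :
    LocIrr W p := by
  have hpp : p.Prime := hp.out
  have hv : (primesEquiv v : ℕ) = p := primesEquiv_eq_of_natCast_mem v hpp hpv
  -- the prime `𝔓₀ ∣ v` cut out by `ℚ̄ → ℚ̄_p`: `D_{𝔓₀} = res Γ_{ℚ_p}`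
  have hO := X11b.PadicInertiaCharacter.norm_algebraMap_ringOfIntegers_le_one p
  obtain ⟨𝔓₀, h𝔓₀⟩ := exists_ideal_forall_mem_iff_spectralNorm_lt_one ℚ ℚ_[p] hO
  have h𝔓₀v : 𝔓₀ ∈ v.primesAbove :=
    mem_primesAbove_of_forall_mem_iff v
      (X11b.PadicInertiaCharacter.norm_algebraMap_ringOfIntegers_lt_one_iff p v hv) 𝔓₀ h𝔓₀
  have hD : 𝔓₀.decompositionSubgroup (absoluteGaloisGroup ℚ) =
      (absGaloisRestrict ℚ ℚ_[p]).toMonoidHom.range :=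
    decompositionSubgroup_eq_range_absGaloisRestrict
      (X11b.PadicInertiaCharacter.denseRange_algebraMap p) hO
      (X11b.PadicInertiaCharacter.exists_norm_algebraMap_lt_one p) 𝔓₀ h𝔓₀
  -- no `I_{𝔓₀}`-stable line either (conjugate primes)
  have hno₀ := GaloisImage.not_exists_stableLine_of_mem_primesAbove (W := W) (p := p) h𝔓 h𝔓₀v hno
  -- a stable subgroup `H ≠ ⊥, ⊤` of the local module has order `p`
  intro H hH
  by_contra hne
  rw [not_or] at hne
  obtain ⟨hbot, htop⟩ := hne
  have hcardE := natCard_geomTorsion_baseChange_padic W p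
  haveI : Finite (geomTorsion (W.baseChange ℚ_[p]) (p : ℤ)) :=
    Nat.finite_of_card_ne_zero (by rw [hcardE]; exact pow_ne_zero 2 hpp.ne_zero)
  have hcardH : Nat.card H = p := by
    have hdvd : Nat.card H ∣ p ^ 2 := hcardE ▸ H.card_addSubgroup_dvd_card
    obtain ⟨i, hi, hHi⟩ := (Nat.dvd_prime_pow hpp).mp hdvd
    interval_cases i
    · exact absurd (AddSubgroup.card_eq_one.mp (by simpa using hHi)) hbot
    · simpa using hHi
    · exact absurd ((AddSubgroup.card_eq_iff_eq_top H).mp (by rw [hHi, hcardE])) htop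
  -- transfer to `E[p](ℚ̄)`
  have hp0 : (p : ℤ) ≠ 0 := by exact_mod_cast hpp.ne_zero
  let t := W.torsionTransferEquiv (E := ℚ_[p]) hp0
  let Φ : AddSubgroup (geomTorsion W (p : ℤ)) := H.comap t.toAddMonoidHom
  have hmemΦ : ∀ P, P ∈ Φ ↔ t P ∈ H := fun P ↦ Iff.rfl
  have hΦ : Nat.card Φ = p :=
    (Nat.card_congr
      { toFun := fun P ↦ ⟨t P.1, (hmemΦ P.1).mp P.2⟩
        invFun := fun Q ↦ ⟨t.symm Q.1, by rw [hmemΦ, t.apply_symm_apply]; exact Q.2⟩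
        left_inv := fun P ↦ Subtype.ext (t.symm_apply_apply P.1)
        right_inv := fun Q ↦ Subtype.ext (t.apply_symm_apply Q.1) : Φ ≃ H }).trans hcardH
  -- `Φ` is stable under `I_{𝔓₀} ≤ D_{𝔓₀} = res (Γ_{ℚ_p})`
  have hstab : ∀ s ∈ 𝔓₀.inertia (absoluteGaloisGroup ℚ), ∀ P ∈ Φ, s • P ∈ Φ := by
    intro s hs P hP
    have hsD : s ∈ 𝔓₀.decompositionSubgroup (absoluteGaloisGroup ℚ) :=
      Ideal.inertia_le_decompositionSubgroup _ _ hs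
    rw [hD] at hsD
    obtain ⟨σ, hσ⟩ := MonoidHom.mem_range.mp hsD
    rw [hmemΦ] at hP ⊢
    rw [← hσ]
    change t (absGaloisRestrict ℚ ℚ_[p] σ • P) ∈ H
    rw [W.torsionTransferEquiv_smul (E := ℚ_[p]) hp0 σ P]
    exact hH σ _ hP
  exact hno₀ ⟨Φ, hΦ, hstab⟩

/-- Contrapositive: **`E[p]|G_{ℚ_p}` reducible ⟹ an `I_𝔓`-stable line of `E[p](ℚ̄)`** at every
`𝔓 ∣ p`. [cite: NeukirchANT1999, Ch. I §9 Prop. (9.1) and Ch. II §9 Prop. (9.6)] -/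
theorem exists_inertia_stableLine_of_not_locIrr (hpv : ((p : ℕ) : 𝓞 ℚ) ∈ v.asIdeal)
    {𝔓 : Ideal (absIntegers (𝓞 ℚ) ℚ)} (h𝔓 : 𝔓 ∈ v.primesAbove) (hred : ¬ LocIrr W p) :
    ∃ L : AddSubgroup (geomTorsion W (p : ℤ)), Nat.card L = p ∧
      ∀ σ ∈ 𝔓.inertia (absoluteGaloisGroup ℚ), ∀ P ∈ L, σ • P ∈ L := by
  by_contra hno
  exact hred (locIrr_of_not_exists_inertia_stableLine W p hpv h𝔓 hno)

/-! ## §2 A `D_𝔓`-stable line ⟹ `¬ LocIrr`; inertia-split with `ρ̄(I_𝔓) ≠ 1` ⟹ `¬ LocIrr` -/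

/-- **A `D_𝔓`-stable line of `E[p](ℚ̄)`, for ANY prime `𝔓 ∣ p` of `ℤ̄`, makes `E[p]|G_{ℚ_p}`
reducible.** p05's `not_locIrr_of_stable_line` is the case of the prime `𝔓₁` cut out by
`ℚ̄ → \bar ℚ_v` (`D_{𝔓₁} = res Γ_{ℚ_v}`); a general `𝔓 ∣ v` is `g • 𝔓₁` (Neukirch I (9.1)) and
`D_{g𝔓₁} = g D_{𝔓₁} g⁻¹`, so `g⁻¹Φ` is `res Γ_{ℚ_v}`-stable.
[cite: NeukirchANT1999, Ch. I §9 Prop. (9.1) and remark after (9.5)] -/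
theorem not_locIrr_of_decompositionSubgroup_stableLine (hpv : ((p : ℕ) : 𝓞 ℚ) ∈ v.asIdeal)
    {𝔓 : Ideal (absIntegers (𝓞 ℚ) ℚ)} (h𝔓 : 𝔓 ∈ v.primesAbove)
    {Φ : AddSubgroup (geomTorsion W (p : ℤ))} (hΦ : Nat.card Φ = p)
    (hstab : ∀ δ ∈ 𝔓.decompositionSubgroup (absoluteGaloisGroup ℚ), ∀ P ∈ Φ, δ • P ∈ Φ) :
    ¬ LocIrr W p := by
  -- the prime `𝔓₁ ∣ v` cut out by `ℚ̄ → \bar ℚ_v`: `D_{𝔓₁} = res Γ_{ℚ_v}`, and `g • 𝔓₁ = 𝔓`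
  have h𝔓₁ : adicCompletionPrime ℚ v ∈ v.primesAbove := adicCompletionPrime_mem_primesAbove ℚ v
  have hD₁ := decompositionSubgroup_adicCompletionPrime_eq_range (K := ℚ) (v := v)
  obtain ⟨g, hg⟩ :=
    HeightOneSpectrum.exists_smul_eq_of_mem_primesAbove_holds (K := ℚ) (v := v) h𝔓₁ h𝔓
  -- `Φ₁ = g⁻¹ Φ = {P | g • P ∈ Φ}`
  let Φ₁ : AddSubgroup (geomTorsion W (p : ℤ)) :=
    Φ.comap (DistribSMul.toAddMonoidHom (geomTorsion W (p : ℤ)) g)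
  have hmemΦ₁ : ∀ P, P ∈ Φ₁ ↔ g • P ∈ Φ := fun P ↦ Iff.rfl
  have hΦ₁ : Nat.card Φ₁ = p :=
    (Nat.card_congr
      { toFun := fun P ↦ ⟨g • P.1, (hmemΦ₁ P.1).mp P.2⟩
        invFun := fun Q ↦ ⟨g⁻¹ • Q.1, by rw [hmemΦ₁, smul_inv_smul]; exact Q.2⟩
        left_inv := fun P ↦ Subtype.ext (inv_smul_smul g P.1)
        right_inv := fun Q ↦ Subtype.ext (smul_inv_smul g Q.1) : Φ₁ ≃ Φ }).trans hΦ
  refine not_locIrr_of_stable_line W p hpv hΦ₁ ?_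
  intro σ P hP
  rw [hmemΦ₁] at hP ⊢
  -- `res σ ∈ D_{𝔓₁}`, so `g (res σ) g⁻¹ ∈ D_{g • 𝔓₁} = D_𝔓`
  have hmem : absGaloisRestrict ℚ (v.adicCompletion ℚ) σ ∈
      (adicCompletionPrime ℚ v).decompositionSubgroup (absoluteGaloisGroup ℚ) := by
    rw [hD₁]; exact MonoidHom.mem_range.mpr ⟨σ, rfl⟩
  have hconj : MulAut.conj g • absGaloisRestrict ℚ (v.adicCompletion ℚ) σ ∈
      𝔓.decompositionSubgroup (absoluteGaloisGroup ℚ) := by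
    rw [← hg, Ideal.decompositionSubgroup_smul]
    exact Subgroup.smul_mem_pointwise_smul _ _ _ hmem
  have h := hstab _ hconj _ hP
  rw [MulAut.smul_def, MulAut.conj_apply, mul_smul, mul_smul, inv_smul_smul] at h
  exact h

omit [W.IsElliptic] hp in
/-- `D_𝔓` normalises `I_𝔓`: for `δ ∈ D_𝔓` and `σ ∈ I_𝔓`, `δ⁻¹ σ δ ∈ I_𝔓` (`I_{τ𝔓} = τ I_𝔓 τ⁻¹`
with `τ = δ⁻¹`, `δ⁻¹ • 𝔓 = 𝔓`). [cite: NeukirchANT1999, Ch. I §9 (9.4)] -/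
theorem inv_mul_mul_mem_inertia_of_mem_decompositionSubgroup {𝔓 : Ideal (absIntegers (𝓞 ℚ) ℚ)}
    {δ σ : absoluteGaloisGroup ℚ} (hδ : δ ∈ 𝔓.decompositionSubgroup (absoluteGaloisGroup ℚ))
    (hσ : σ ∈ 𝔓.inertia (absoluteGaloisGroup ℚ)) :
    δ⁻¹ * σ * δ ∈ 𝔓.inertia (absoluteGaloisGroup ℚ) := by
  have hδ' : δ⁻¹ • 𝔓 = 𝔓 := Ideal.mem_decompositionSubgroup_iff.mp (inv_mem hδ)
  have h := (Ideal.conj_mem_inertia_smul_iff 𝔓 δ⁻¹ σ).mpr hσ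
  rwa [inv_inv, hδ'] at h

omit [W.IsElliptic] hp in
/-- A non-trivial inertia image `ρ̄_{E,p}(I) ≠ 1` moves some point of `E[p]`. [folklore] -/
theorem exists_smul_ne_of_card_map_galoisRepTorsion_ne_one {I : Subgroup (absoluteGaloisGroup ℚ)}
    (h : Nat.card (I.map (galoisRepTorsion W p)) ≠ 1) :
    ∃ σ ∈ I, ∃ P : geomTorsion W (p : ℤ), σ • P ≠ P := by
  by_contra hall
  push Not at hall
  apply h
  have hbot : I.map (galoisRepTorsion W p) = ⊥ := by
    rw [Subgroup.map_eq_bot_iff]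
    intro σ hσ
    rw [MonoidHom.mem_ker, galoisRepTorsion_eq_one_iff']
    exact hall σ hσ
  rw [hbot, Subgroup.card_bot]

/-- **A line FIXED by `I_𝔓` plus one point MOVED by `I_𝔓` give a `D_𝔓`-stable line: the `I_𝔓`-FIXED
points.** If some line `Y ≤ E[p](ℚ̄)` (order `p`) is fixed pointwise by `I_𝔓` and some inertia element
moves some point, the subgroup `E[p]^{I_𝔓}` contains `Y` and is not all of `E[p]`, so it IS a line
(`#E[p] = p²`); it is `D_𝔓`-stable because `D_𝔓` normalises `I_𝔓`. This is the common core of the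
TWISTED-ORDINARY shape `(1 ∗; 0 χ)`, `χ ≠ 1`, and of the INERTIA-SPLIT shape `χ ⊕ 1` with `ρ̄(I_𝔓) ≠ 1`
(`Additive/MixedCongruenceTameness.lean`). [cite: Serre1972, §1.3–§1.11] [cite: NeukirchANT1999, Ch. I §9 (9.4)] -/
theorem exists_decompositionSubgroup_stableLine_of_inertia_fixedLine
    {𝔓 : Ideal (absIntegers (𝓞 ℚ) ℚ)}
    (hfix : ∃ Y : AddSubgroup (geomTorsion W (p : ℤ)), Nat.card Y = p ∧
      ∀ σ ∈ 𝔓.inertia (absoluteGaloisGroup ℚ), ∀ P ∈ Y, σ • P = P)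
    (hnt : ∃ σ ∈ 𝔓.inertia (absoluteGaloisGroup ℚ), ∃ P : geomTorsion W (p : ℤ), σ • P ≠ P) :
    ∃ Φ : AddSubgroup (geomTorsion W (p : ℤ)), Nat.card Φ = p ∧
      ∀ δ ∈ 𝔓.decompositionSubgroup (absoluteGaloisGroup ℚ), ∀ P ∈ Φ, δ • P ∈ Φ := by
  have hpp : p.Prime := hp.out
  set I := 𝔓.inertia (absoluteGaloisGroup ℚ) with hIdef
  obtain ⟨Y, hY, hYfix⟩ := hfix
  -- the fixed points of `I`
  let F : AddSubgroup (geomTorsion W (p : ℤ)) :=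
    { carrier := {P | ∀ σ ∈ I, σ • P = P}
      add_mem' := fun {P Q} hP hQ σ hσ ↦ by rw [smul_add, hP σ hσ, hQ σ hσ]
      zero_mem' := fun σ _ ↦ smul_zero σ
      neg_mem' := fun {P} hP σ hσ ↦ by rw [smul_neg, hP σ hσ] }
  have hmemF : ∀ P, P ∈ F ↔ ∀ σ ∈ I, σ • P = P := fun P ↦ Iff.rfl
  have hYF : Y ≤ F := fun P hP ↦ (hmemF P).mpr fun σ hσ ↦ hYfix σ hσ P hP
  have hFtop : F ≠ ⊤ := by
    intro htop
    obtain ⟨σ, hσ, P, hP⟩ := hnt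
    exact hP ((hmemF P).mp (htop ▸ AddSubgroup.mem_top P) σ hσ)
  -- `#F = p`
  have hE : Nat.card (geomTorsion W (p : ℤ)) = p ^ 2 :=
    Literature.NumberTheory.EllipticCurves.natCard_geomTorsion W p
  haveI : Finite (geomTorsion W (p : ℤ)) :=
    Nat.finite_of_card_ne_zero (by rw [hE]; exact pow_ne_zero 2 hpp.ne_zero)
  have hF : Nat.card F = p := by
    have hdvd : Nat.card F ∣ p ^ 2 := by
      have h := F.card_addSubgroup_dvd_card
      rwa [hE] at h
    have hpF : p ∣ Nat.card F := by
      have h := AddSubgroup.card_dvd_of_le hYF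
      rwa [hY] at h
    obtain ⟨i, hi, hFi⟩ := (Nat.dvd_prime_pow hpp).mp hdvd
    interval_cases i
    · rw [pow_zero] at hFi
      rw [hFi] at hpF
      exact absurd (Nat.le_of_dvd one_pos hpF) (not_le.mpr hpp.one_lt)
    · simpa using hFi
    · exact absurd ((AddSubgroup.card_eq_iff_eq_top F).mp (by rw [hFi, hE])) hFtop
  refine ⟨F, hF, ?_⟩
  intro δ hδ P hP
  rw [hmemF] at hP ⊢
  intro σ hσ
  have hconj : δ⁻¹ * σ * δ ∈ I := inv_mul_mul_mem_inertia_of_mem_decompositionSubgroup hδ hσ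
  calc σ • δ • P = (σ * δ) • P := (mul_smul σ δ P).symm
    _ = (δ * (δ⁻¹ * σ * δ)) • P := by rw [← mul_assoc, ← mul_assoc, mul_inv_cancel, one_mul]
    _ = δ • ((δ⁻¹ * σ * δ) • P) := mul_smul _ _ _
    _ = δ • P := by rw [hP _ hconj]

/-- **An `I_𝔓`-fixed line plus a point moved by `I_𝔓` ⟹ `E[p]|G_{ℚ_p}` REDUCIBLE**, at every prime `p`
and every `𝔓 ∣ p` (the `I_𝔓`-fixed points form a `D_𝔓`-stable line).
[cite: Serre1972, §1.3–§1.11] [cite: NeukirchANT1999, Ch. I §9 (9.1), (9.4) and Ch. II §9 (9.6)] -/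
theorem not_locIrr_of_inertia_fixedLine (hpv : ((p : ℕ) : 𝓞 ℚ) ∈ v.asIdeal)
    {𝔓 : Ideal (absIntegers (𝓞 ℚ) ℚ)} (h𝔓 : 𝔓 ∈ v.primesAbove)
    (hfix : ∃ Y : AddSubgroup (geomTorsion W (p : ℤ)), Nat.card Y = p ∧
      ∀ σ ∈ 𝔓.inertia (absoluteGaloisGroup ℚ), ∀ P ∈ Y, σ • P = P)
    (hnt : ∃ σ ∈ 𝔓.inertia (absoluteGaloisGroup ℚ), ∃ P : geomTorsion W (p : ℤ), σ • P ≠ P) :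
    ¬ LocIrr W p := by
  obtain ⟨Φ, hΦ, hstab⟩ :=
    exists_decompositionSubgroup_stableLine_of_inertia_fixedLine W p hfix hnt
  exact not_locIrr_of_decompositionSubgroup_stableLine W p hpv h𝔓 hΦ hstab

/-- **TWISTED-ORDINARY shape at `I_𝔓` (`(1 ∗; 0 χ)`, `χ ≠ 1`: `TwistedOrdinaryLineAt W p I_𝔓`) ⟹
`E[p]|G_{ℚ_p}` REDUCIBLE**, at every prime `p` and every `𝔓 ∣ p` — the residual shape of the additive
potentially ordinary / potentially multiplicative rows (the `ω`-twist of the good-ordinary / Tate shape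
`(ω ∗; 0 1)`; cf. EPW 2006 §3.1 (eq:ordes) for that shape, Delbourgo 1998 p. 130).
[cite: Serre1972, §1.11] cf. [cite: EmertonPollackWeston2006, §3.1 (eq:ordes) (arXiv:math/0404484, arXiv p. 17)] -/
theorem not_locIrr_of_twistedOrdinaryLineAt (hpv : ((p : ℕ) : 𝓞 ℚ) ∈ v.asIdeal)
    {𝔓 : Ideal (absIntegers (𝓞 ℚ) ℚ)} (h𝔓 : 𝔓 ∈ v.primesAbove)
    (htw : TwistedOrdinaryLineAt W p (𝔓.inertia (absoluteGaloisGroup ℚ))) : ¬ LocIrr W p := by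
  obtain ⟨L, hL, hLfix, σ, hσ, P, hP⟩ := htw
  refine not_locIrr_of_inertia_fixedLine W p hpv h𝔓 ⟨L, hL, hLfix⟩ ⟨σ, hσ, P, ?_⟩
  intro h
  exact hP (by rw [h, sub_self]; exact zero_mem L)

/-- **INERTIA-SPLIT shape (`E[p]|_{I_𝔓} ≅ χ ⊕ 1`: `InertiaSplitAt W p I_𝔓`) with `ρ̄_{E,p}(I_𝔓) ≠ 1`
⟹ `E[p]|G_{ℚ_p}` REDUCIBLE**, at every prime `p` and every `𝔓 ∣ p` (the split's fixed summand `Y`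
and a moved point feed `not_locIrr_of_inertia_fixedLine`).
[cite: Serre1972, §1.3–§1.11] [cite: Edixhoven1997Serre, §4.2 (held chunk p0297)] -/
theorem not_locIrr_of_inertiaSplitAt (hpv : ((p : ℕ) : 𝓞 ℚ) ∈ v.asIdeal)
    {𝔓 : Ideal (absIntegers (𝓞 ℚ) ℚ)} (h𝔓 : 𝔓 ∈ v.primesAbove)
    (hsplit : InertiaSplitAt W p (𝔓.inertia (absoluteGaloisGroup ℚ)))
    (hnt : Nat.card ((𝔓.inertia (absoluteGaloisGroup ℚ)).map (galoisRepTorsion W p)) ≠ 1) :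
    ¬ LocIrr W p := by
  obtain ⟨-, Y, -, hY, -, -, -, hYfix⟩ := hsplit
  exact not_locIrr_of_inertia_fixedLine W p hpv h𝔓 ⟨Y, hY, hYfix⟩
    (exists_smul_ne_of_card_map_galoisRepTorsion_ne_one W p hnt)

end Bridge

end Summit.BirchSwinnertonDyer.Rank1Residual.Additive

end
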